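import Summits.BirchSwinnertonDyer.BirchSwinnertonDyer.Theorems.AdditiveBranchIMCGordTwoRankZeroOffCaseOneThreeFieldRowClosed
import Literature.NumberTheory.EllipticCurves.HeegnerPointsOfConductorRationalityBirchProofs
import HarnessLib

/-!
# Line `three_field_road` (crux `GordTwoRankZeroOffCaseOne`, stmt-BirchSwinnertonDyer-19357) — THE SUB-ROW THEOREM FROM FIFTEEN PRINTED FACTS

Sequel of `AdditiveBranchIMCGordTwoRankZeroOffCaseOneThreeFieldRowClosed.lean` (p725201 / p727765, LEAD g8:
`ThreeFieldRowClosed.missingLowerBoundAt_rankZero_of_threeFieldRow_sixteenFacts`). Of its sixteen named printed hypotheses, ONE MORE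
IS NOW A THEOREM OF THE TREE: the Birch-keyed CM rationality of the Heegner points of conductor `n`
(`phi_heegnerPointOfConductor_mem_range_map_ringClassField_birch`, Darmon 2004 Thm. 3.6 at `τ = x(n)` under `4N ∣ β² − d_K`,
conjunct (G1) of field 2 = the genus Kolyvagin system over the `p`-ramified field `K″`) is DISCHARGED by
`forall_phi_heegnerPointOfConductor_mem_range_map_ringClassField_birch` (`Literature/…/HeegnerPointsOfConductorRationalityBirchProofs.lean`,
p730874, LEAD g9: one application of the tree's hypothesis-free Shimura-transport theorem
`phi_heegnerPointOfConductor_mem_range_map_ringClassField_of_ne_zero`). Hence: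

* `missingLowerBoundAt_rankZero_of_threeFieldRow_fifteenFacts` — on the three-field sub-row of cell (G-ord, `e = 2`) in analytic
  rank `0`, `ord_p #Ш(E)_an ≤ ord_p #Ш(E)` GIVEN FIFTEEN printed theorems (Friedberg–Hoffstein F6, GZK over `ℚ`, a modular
  parametrisation, Gross–Zagier I.(7.3), Skinner–Urban 2014 Thm. 2 (a), Cai–Shu–Tian 2014 Thm. 1.1 ×2, Mazur 1978 Cor. 4.1, Hsieh 2014
  Thm. B, Liu–Zhang–Zhang 2018, Hoffstein–Luo 1997, Nekovář 2007 (4.9), Gross 1991 Prop. 5.3 pinned, Castella–Liu–Wan 2022 Thm. 8.2.1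
  and §6.1);
* `gordTwoRankZeroOffCaseOne_of_fifteenFacts_of_residual` — the crux `AdditiveBranchIMC.GordTwoRankZeroOffCaseOne` BY NAME from the same
  fifteen facts and the residual statement (the registered research stub `stub_residualR0`).

THEOREMS ONLY; conditional on the named hypotheses; BSD is proved for no curve by this file; the crux item stays OPEN.
-/

noncomputable section

set_option linter.dupNamespace false

namespace Summit.BirchSwinnertonDyer.BirchSwinnertonDyer.Theorems.ThreeFieldRowClosed

open scoped Classical

open NumberField IsDedekindDomain
open WeierstrassCurve Literature.NumberTheory.EllipticCurves
  Literature.NumberTheory.EllipticCurves.ModularForms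
  Literature.NumberTheory.EllipticCurves.Rank1Residual
  Literature.NumberTheory.EllipticCurves.Rank1Residual.Typed

open Summit.BirchSwinnertonDyer.Rank1Residual
open Summit.BirchSwinnertonDyer.Rank1Residual.Additive
open Summit.BirchSwinnertonDyer.BirchSwinnertonDyer.Theorems
open Field Literature.NumberTheory.EllipticCurves.ModularForms
open ThreeFieldRoadSupply
open Summit.BirchSwinnertonDyer.BirchSwinnertonDyer.Theses.AdditiveBranchIMC

/-- **THE THREE-FIELD SUB-ROW FROM FIFTEEN PRINTED THEOREMS.** Of the sixteen named hypotheses of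
`missingLowerBoundAt_rankZero_of_threeFieldRow_sixteenFacts`, the Birch-keyed CM rationality
`phi_heegnerPointOfConductor_mem_range_map_ringClassField_birch` (Darmon 2004 Thm. 3.6 at `x(n)`) is a THEOREM OF THE TREE
(`forall_phi_heegnerPointOfConductor_mem_range_map_ringClassField_birch`). So: for every `E/ℚ` (globally minimal `W`) of analytic
rank `0` and every prime `p` of cell (G-ord, `e = 2`) on the three-field sub-row (`p ≥ 5`, `ρ̄_{E,p}` onto, `E` semistable outside `p`,
a Wan prime, `p ∤ ∏ c_ℓ(E)`), `ord_p #Ш(E)_an ≤ ord_p #Ш(E)` GIVEN FIFTEEN printed theorems as named hypotheses.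
[cite: Darmon2004, Thm. 3.6 (PDF pp. 43–44)] [cite: JetchevSkinnerWan2017, §7.4.1 (arXiv:1512.06894 p. 30)]
[cite: CastellaLiuWan2022, Thm. 8.2.1 (1)] [cite: GrossLMS1991, §§3–6, Prop. 5.3] -/
theorem missingLowerBoundAt_rankZero_of_threeFieldRow_fifteenFacts
    (hF6 : friedbergHoffstein_exists_twist_simpleZero_ramifiedAt_splitAt)
    (hGZK : rank_eq_analyticRank_of_analyticRank_le_one)
    (hmodP : nonempty_modularParametrizationData) (hGZ73 : GrossZagier1986_thm_I_7_3)
    (hSU : padicValRat_bsd_rank_zero) (hCST : CaiShuTian2014.thm11_trivialChar)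
    (hCSTrc : CaiShuTian2014.thm11_ringClassChar) (hMaz : mazur_not_dvd_maninConstant_of_odd)
    (hB : Hsieh2014.thmB_exists_isHsiehLFunction_coeff_norm_eq_one_unrPeriod_ramifiedSteinberg)
    (hLZZ : LiuZhangZhang2018.thm151_thm153_modularCurve_heegnerVector_additive_ramifiedSteinberg)
    (hHL : HoffsteinLuo1997_exists_twist_L_one_ne_zero)
    (hNek : Nekovar2007.cmPoint_frobeniusCongruence)
    (hP53 : ∀ (N : ℕ) [NeZero N] (W : WeierstrassCurve ℚ) (K : Type) [Field K] [NumberField K],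
      GrossLMS1991.prop53_conj_pinned_birch N W K)
    (h821 : CastellaLiuWan2022.thm821_XGr₂_charIdeal_mul_le_awayFromCyc_pStarTwist)
    (h61 : CastellaLiuWan2022.sec61_exists_isCastellaLiuWanLFunction₂_pStarTwist)
    (W : WeierstrassCurve ℚ) [W.IsElliptic] [W.IsGloballyMinimal] (p : ℕ) [Fact p.Prime]
    (hr : W.analyticRank = 0) (hcell : N10.CellGordTwo W p) (hrow : ThreeFieldRow W p) :
    MissingLowerBoundAt W p :=
  missingLowerBoundAt_rankZero_of_threeFieldRow_sixteenFacts hF6 hGZK hmodP hGZ73 hSU hCST hCSTrc hMaz hB hLZZ hHL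
    forall_phi_heegnerPointOfConductor_mem_range_map_ringClassField_birch hNek hP53 h821 h61 W p hr hcell hrow

/-- **THE CRUX FROM FIFTEEN PRINTED THEOREMS AND THE RESIDUAL** — the registered skeleton's composition
`ThreeFieldRoad.GordTwoRankZeroOffCaseOne_of` with both registered stubs as hypotheses, the cite stub shrunk to fifteen conjuncts: by
cases on «the curve lies on the three-field sub-row» — on it `missingLowerBoundAt_rankZero_of_threeFieldRow_fifteenFacts`, off it the
residual statement (`p = 3`; `ρ̄` not onto; a second additive prime; no Wan prime; `p ∣ ∏ c_ℓ(E)` — research, by design). Concludes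
`AdditiveBranchIMC.GordTwoRankZeroOffCaseOne` BY NAME; conditional on its hypotheses; closes nothing.
[cite: Darmon2004, Thm. 3.6 (PDF pp. 43–44)] [cite: CastellaLiuWan2022, Thm. 8.2.1 (1)] -/
theorem gordTwoRankZeroOffCaseOne_of_fifteenFacts_of_residual
    (hF6 : friedbergHoffstein_exists_twist_simpleZero_ramifiedAt_splitAt)
    (hGZK : rank_eq_analyticRank_of_analyticRank_le_one)
    (hmodP : nonempty_modularParametrizationData) (hGZ73 : GrossZagier1986_thm_I_7_3)
    (hSU : padicValRat_bsd_rank_zero) (hCST : CaiShuTian2014.thm11_trivialChar)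
    (hCSTrc : CaiShuTian2014.thm11_ringClassChar) (hMaz : mazur_not_dvd_maninConstant_of_odd)
    (hB : Hsieh2014.thmB_exists_isHsiehLFunction_coeff_norm_eq_one_unrPeriod_ramifiedSteinberg)
    (hLZZ : LiuZhangZhang2018.thm151_thm153_modularCurve_heegnerVector_additive_ramifiedSteinberg)
    (hHL : HoffsteinLuo1997_exists_twist_L_one_ne_zero)
    (hNek : Nekovar2007.cmPoint_frobeniusCongruence)
    (hP53 : ∀ (N : ℕ) [NeZero N] (W : WeierstrassCurve ℚ) (K : Type) [Field K] [NumberField K],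
      GrossLMS1991.prop53_conj_pinned_birch N W K)
    (h821 : CastellaLiuWan2022.thm821_XGr₂_charIdeal_mul_le_awayFromCyc_pStarTwist)
    (h61 : CastellaLiuWan2022.sec61_exists_isCastellaLiuWanLFunction₂_pStarTwist)
    (hres : ∀ (W : WeierstrassCurve ℚ) [W.IsElliptic] [W.IsGloballyMinimal] (p : ℕ) [Fact p.Prime],
      W.analyticRank = 0 → N10.CellGordTwo W p → ¬ HasCaseOneMember W p → ¬ ThreeFieldRow W p →
        MissingLowerBoundAt W p) :
    GordTwoRankZeroOffCaseOne := by
  intro W _ _ p _ hr hcell hc1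
  by_cases hs : ThreeFieldRow W p
  · exact missingLowerBoundAt_rankZero_of_threeFieldRow_fifteenFacts hF6 hGZK hmodP hGZ73 hSU hCST hCSTrc hMaz hB hLZZ hHL
      hNek hP53 h821 h61 W p hr hcell hs
  · exact hres W p hr hcell hc1 hs

end Summit.BirchSwinnertonDyer.BirchSwinnertonDyer.Theorems.ThreeFieldRowClosed

end
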